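import Literature.MathematicalPhysics.QuantumFieldTheory.OSPointVectorContinuity
import Literature.MathematicalPhysics.QuantumFieldTheory.OSGapConfigurations
import Literature.MathematicalPhysics.QuantumFieldTheory.OSDistributionSpaceHolomorphicSemigroupLaw
import Literature.MathematicalPhysics.QuantumFieldTheory.OSLabelledPieces
import HarnessLib

/-!
# The labelled real-point vectors of a Schwinger family

Topic `Literature/MathematicalPhysics/QuantumFieldTheory`; support file (all proved; the labelled
configuration and vector as definitions; no named facts) for the discharge of (A1)
`OS1975_exists_timeContinuation`: the second step of the instantiation of the abstract continuation
engine (`OSLabelledPieces` … `OSTemperedBound`) on an actual Schwinger family.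
Osterwalder–Schrader II (Comm. Math. Phys. 42 (1975)), Ch. V (5.2) and Ch. V.2 (5.16)–(5.17): the
vectors `Ψₙ(x, ξ)` of the configuration with first time `x`, time gaps `ξ` and prescribed spatial
positions (the *labels*), realised by the point vectors of `OSPointVectors` (Thm. 4.1 + (P₀)); they
are translated by the semigroup, `e^{-tH} Ψₙ(x, ξ) = Ψₙ(x + t, ξ)` — the hypothesis
`OSEnvelope.IsOSLabelledVectors` of the engine, with the label space `E = ℝᵈ` (full points; only
their spatial parts enter).

* `labCfg a x ξ` — the configuration with spatial parts those of `a`, times `x, x + ξ₀, …`;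
* `labVec hE2 n a x ξ` — its point vector (junk `0` unless `x > 0`, `ξ > 0`);
* `isOSLabelledVectors_labVec` — `e^{-tH} labVec(x) = labVec(x + t)`.

## References

* K. Osterwalder, R. Schrader, *Axioms for Euclidean Green's functions II*, Comm. Math. Phys.
  42 (1975) 281–305, Ch. V (5.2), Ch. V.2 (5.16)–(5.17). [OsterwalderSchraderCMP1975]
-/

noncomputable section

open scoped InnerProductSpace

namespace Literature.MathematicalPhysics.QuantumFieldTheory

variable {d : ℕ} [NeZero d]

open Literature.MathematicalPhysics.QuantumLattice (SchwingerFamily)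
open Literature.MathematicalPhysics.QuantumLattice.SchwingerFamily
open Literature.MathematicalPhysics.QuantumLattice.SchwingerFamily.OSSpace
open Literature.MathematicalPhysics.QuantumFieldTheory.OSEnvelope

/-! ### Labelled configurations -/

section Config

variable {n : ℕ}

/-- **The labelled configuration** with spatial parts those of the labels `a`, first time `x` and
time gaps `ξ`: `(labCfg a x ξ)_j = (x + ξ₀ + ⋯ + ξ_{j-1}, a⃗_j)`. [cite: OsterwalderSchraderCMP1975, Ch. V (5.2)] -/
def labCfg (a : Fin (n + 1) → EuclideanSpace ℝ (Fin d)) (x : ℝ) (ξ : Fin n → ℝ) :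
    Fin (n + 1) → EuclideanSpace ℝ (Fin d) :=
  fun j => a j + timeVec (x + Fin.partialSum ξ j - a j 0)

/-- Times of the labelled configuration. [folklore] -/
@[simp] theorem labCfg_apply_zero (a : Fin (n + 1) → EuclideanSpace ℝ (Fin d)) (x : ℝ) (ξ : Fin n → ℝ) (j : Fin (n + 1)) :
    labCfg a x ξ j 0 = x + Fin.partialSum ξ j := by
  simp [labCfg]

/-- Spatial parts of the labelled configuration are those of the labels. [folklore] -/
theorem labCfg_apply_of_ne_zero (a : Fin (n + 1) → EuclideanSpace ℝ (Fin d)) (x : ℝ) (ξ : Fin n → ℝ) (j : Fin (n + 1))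
    {μ : Fin d} (hμ : μ ≠ 0) : labCfg a x ξ j μ = a j μ := by
  simp [labCfg, hμ]

/-- The labelled configuration is positive-time ordered for `x > 0`, `ξ > 0`. [folklore] -/
theorem posOrdered_labCfg (a : Fin (n + 1) → EuclideanSpace ℝ (Fin d)) {x : ℝ} (hx : 0 < x) {ξ : Fin n → ℝ}
    (hξ : ∀ i, 0 < ξ i) : PosOrdered (labCfg a x ξ) := by
  refine ⟨by simp [hx], ?_⟩
  refine Fin.strictMono_iff_lt_succ.2 fun j => ?_
  simp only [labCfg_apply_zero, Fin.partialSum_succ]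
  linarith [hξ j]

/-- Time translation of the labelled configuration shifts the first time. [folklore] -/
theorem labCfg_add_timeVec (a : Fin (n + 1) → EuclideanSpace ℝ (Fin d)) (x t : ℝ) (ξ : Fin n → ℝ) :
    (fun j => labCfg a x ξ j + timeVec t) = labCfg a (x + t) ξ := by
  funext j
  simp only [labCfg, add_assoc, ← timeVec_add]
  congr 2
  ring

/-- The labelled configuration depends only on the spatial parts of the labels. [folklore] -/
theorem labCfg_add_timeVec_labels (a : Fin (n + 1) → EuclideanSpace ℝ (Fin d)) (c : Fin (n + 1) → ℝ) (x : ℝ) (ξ : Fin n → ℝ) :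
    labCfg (fun j => a j + timeVec (c j)) x ξ = labCfg a x ξ := by
  funext j
  ext μ
  by_cases hμ : μ = 0
  · subst hμ; simp
  · rw [labCfg_apply_of_ne_zero _ _ _ _ hμ, labCfg_apply_of_ne_zero _ _ _ _ hμ]
    simp [hμ]

/-- Continuity of the labelled configuration in the gaps. [folklore] -/
theorem continuous_labCfg (a : Fin (n + 1) → EuclideanSpace ℝ (Fin d)) (x : ℝ) :
    Continuous fun ξ : Fin n → ℝ => labCfg a x ξ := by
  refine continuous_pi fun j => ?_
  simp only [labCfg]
  have hps : Continuous fun ξ : Fin n → ℝ => Fin.partialSum ξ j := by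
    simp only [partialSum_eq_sum_filter]
    exact continuous_finsetSum _ fun i _ => continuous_apply i
  exact continuous_const.add ((QuantumLattice.continuous_single_time d).comp
    ((continuous_const.add hps).sub continuous_const))

end Config

/-! ### Labelled vectors -/

section Vectors

variable {𝔖 : SchwingerFamily (EuclideanSpace ℝ (Fin d))} (hE2 : 𝔖.IsOSReflectionPositive)

/-- **The labelled real-point vectors** `Ψₙ(x, ξ; a) = Ψ(labCfg a x ξ)` (the point vector; junk `0`
off `x > 0`, `ξ > 0`). [cite: OsterwalderSchraderCMP1975, Ch. V.2 (5.16)–(5.17)] -/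
def labVec (n : ℕ) (a : Fin (n + 1) → EuclideanSpace ℝ (Fin d)) (x : ℝ) (ξ : Fin n → ℝ) : OSHilbert 𝔖 hE2 :=
  pointVec hE2 (labCfg a x ξ)

variable {hE2}

/-- Point vectors of equal configurations are equal. [folklore] -/
theorem pointVector_congr {m : ℕ} {x y : Fin (m + 1) → EuclideanSpace ℝ (Fin d)} (h : x = y) (hx : PosOrdered x)
    (hy : PosOrdered y) : pointVector hE2 x hx = pointVector hE2 y hy := by
  subst h; rfl

/-- **The semigroup translates the labelled vectors**: `e^{-tH} Ψₙ(x, ξ; a) = Ψₙ(x + t, ξ; a)` for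
`x, t > 0`, `ξ > 0`. [cite: OsterwalderSchraderCMP1975, Ch. V.2 (5.16)–(5.17)] -/
theorem isOSLabelledVectors_labVec (hE1 : 𝔖.IsEuclideanCovariant) (hE0 : 𝔖.HasLinearGrowth) :
    IsOSLabelledVectors (fun τ => holoShiftH (hE2 := hE2) hE1 τ) (labVec hE2) where
  shift n a x t hx ht ξ hξ := by
    have hpos := posOrdered_labCfg a hx hξ
    have hpos' := posOrdered_labCfg a (x := x + t) (by linarith) hξ
    simp only [labVec]
    rw [holoShiftH_ofReal hE1 ht, pointVec_eq hE2 hpos, pointVec_eq hE2 hpos',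
      shiftH_pointVector hE2 hE1 hE0 hpos ht.le]
    exact pointVector_congr (labCfg_add_timeVec a x t ξ) _ _

end Vectors

end Literature.MathematicalPhysics.QuantumFieldTheory
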